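import Summits.BirchSwinnertonDyer.BirchSwinnertonDyer.Theorems.ByReductionTypeAtTwoOrdKatoHalfAtTwoIsoSteinbergDefs
import Summits.BirchSwinnertonDyer.BirchSwinnertonDyer.Theorems.ByReductionTypeAtTwoOrdKatoHalfAtTwoIsoOmegaRoadDefs
import Summits.BirchSwinnertonDyer.BirchSwinnertonDyer.Theorems.ByReductionTypeAtTwoOrdKatoHalfAtTwoIsoSelmerSideTwo
import Summits.BirchSwinnertonDyer.BirchSwinnertonDyer.Theorems.ByReductionTypeAtTwoOrdKatoHalfAtTwoIsoChebotarevTranspositionTwo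
import Summits.BirchSwinnertonDyer.BirchSwinnertonDyer.Theorems.ByReductionTypeAtTwoOrdKatoHalfAtTwoIsoKolyvaginRankOneTwo
import Summits.BirchSwinnertonDyer.BirchSwinnertonDyer.Theorems.ByReductionTypeAtTwoOrdKatoHalfAtTwoIsoHintOfAbbesUllmo
import HarnessLib

/-!
# Route ByReductionTypeAtTwo, crux `OrdKatoHalfAtTwoIso` (stmt-BirchSwinnertonDyer-19573), line `steinberg-fibre-at-two`:
# SOCKET 1 OF THE RESIDUE PROVED — `CoreTheoremATwoResidue` (the `p = 2` core Theorem A on the DD12 residue) — and the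
# crux CLOSED MODULO its memo/cite binders (F1⁽²⁾ MEMO-5′, B7 ∧ B8 MEMO-6/7, Abbes–Ullmo, the PUB item 19149)

Seat `cruxlead-stmt-BirchSwinnertonDyer-19573-g0` (LEAD PROVER, MODE LINE; HOME `run/shared/lean/pub/bsd-2adic/`).
THEOREMS ONLY. HONEST FRAMING (cell bsd-2adic): BSD is not proved by any of this; the CRUX `OrdKatoHalfAtTwoIso` is NOT
proved unconditionally — `ordKatoHalfAtTwoIso_of_memo_cite` below is CONDITIONAL on four displayed binders that the line
never proves by design (skeleton v1–v8: memo tier = readings of Kato §§12–17 at `p = 2` not in print; cite = Abbes–Ullmo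
1996 Thm A by name and the route's PUB item `OrdPublishedInputsAtTwo`, stmt-19149). What IS proved unconditionally here is
the line's ONE research statement, socket 1 of the residue: `coreTheoremATwoResidue_holds : CoreTheoremATwoResidue`
(Theorems constant of p655368 — the `p = 2` twin of X10's `coreTheoremAOddPrime_holds` on the residue `ρ̄₂` onto,
good ordinary at `2`, `ρ_{2^∞}` not onto), by the Ω road of the stub-critic's STUB-PLAN: `stub_port_of_rankOne`
(kernel composition p658966) applied to the three registered stubs, all PROVED — T1 `stub_T1_selmerSideTwo` (p663770),
Ω1 `stub_HC_chebotarevTranspositionTwo` (p662346), Ω2 `stub_HK_kolyvaginRankOneTwo` (this cycle).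

References: K. Kato, Astérisque 295 (2004) §§12–17 [Kato2004Asterisque]; B. Mazur, K. Rubin, Mem. AMS 799 (2004)
[MazurRubin2004]; A. Abbes, E. Ullmo, Compositio 103 (1996) Thm. A [AbbesUllmo1996]; R. Greenberg, LNM 1716 (1999)
[GreenbergLNM1716].
-/

set_option linter.dupNamespace false
set_option autoImplicit false

noncomputable section

open scoped Classical MatrixGroups ModularForm NumberField
open CongruenceSubgroup WeierstrassCurve Field IsDedekindDomain
open Literature.NumberTheory.GaloisRepresentations
open Literature.NumberTheory.EllipticCurves Literature.NumberTheory.EllipticCurves.ModularForms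
open Literature.NumberTheory.EllipticCurves.Kato2004
  Literature.NumberTheory.EllipticCurves.Kato2004.EulerSystemValues
open Literature.NumberTheory.EllipticCurves.Rank1Residual
open Summit.BirchSwinnertonDyer.BirchSwinnertonDyer.Theorems.Rank1ResidualX1Defs
  Summit.BirchSwinnertonDyer.BirchSwinnertonDyer.Rank1Residual
open Summit.BirchSwinnertonDyer.Rank1Residual Summit.BirchSwinnertonDyer.Rank1Residual.X5
open Summit.BirchSwinnertonDyer.BirchSwinnertonDyer.Theorems.OrdKatoOptimalAtTwo
  Summit.BirchSwinnertonDyer.BirchSwinnertonDyer.Theorems.OrdKatoIntAtTwo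
open Summit.BirchSwinnertonDyer.BirchSwinnertonDyer.Theses.ByReductionTypeAtTwo


namespace Summit.BirchSwinnertonDyer.BirchSwinnertonDyer.Theorems.SteinbergFibreAtTwo

/-- **SOCKET 1 OF THE RESIDUE PROVED: the `p = 2` core Theorem A on the DD12 residue** (`CoreTheoremATwoResidue`,
p655368: for `ρ̄_{E,2}` onto, `E` good ordinary at `2`, `ρ_{E,2^∞}` not onto, a genuine `2`-adic Euler-system class
`s ∉ 2𝐇¹` kills the `E[2]`-lifts of `Sel₀(E/ℚ_∞)` by a power of `T`), by the Ω road: the kernel composition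
`stub_port_of_rankOne` (p658966) of the three PROVED registered stubs T1 (Selmer side at `2`), Ω1 (Chebotarev
transposition prime), Ω2 (Kolyvagin's class of one transposition prime + reciprocity at `2`).
[cite: Kato2004Asterisque, Thm. 12.6 (p. 222) and §13] [cite: MazurRubin2004, Prop. 1.3.2 and §3.6] -/
theorem coreTheoremATwoResidue_holds : CoreTheoremATwoResidue :=
  stub_port_of_rankOne stub_T1_selmerSideTwo stub_HC_chebotarevTranspositionTwo stub_HK_kolyvaginRankOneTwo

/-- **The crux `OrdKatoHalfAtTwoIso` CLOSED MODULO ITS MEMO/CITE BINDERS** (CONDITIONAL; the line's designed endpoint):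
granted socket 2 of the residue (F1⁽²⁾ = `DivisibilityInputsFineZetaAtTwoResidue`, MEMO-5′ — Kato's §17.13 package
at `p = 2` on the residue, a reading not in print), Abbes–Ullmo 1996 Thm. A by name, the two off-residue memo binders
B7 (`KatoMuPartAtOptimalMemberOfNotSurjectiveTwo`, MEMO-7) and B8 (`KatoIntAtGoodOrdSurjectiveTwo`, W_K2 + MEMO-6),
and Kato 17.4 (1)(2) at `p = 2` (third conjunct of the route's PUB item `OrdPublishedInputsAtTwo`, stmt-19149), the
crux follows from the kernel door `ordKatoHalfAtTwoIso_of_sockets` (p655368) with socket 1 DISCHARGED by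
`coreTheoremATwoResidue_holds`. Nothing else is asserted. [cite: Kato2004Asterisque, Thm. 17.4 (1)(2) (p. 273)]
[cite: AbbesUllmo1996, Thm. A] -/
theorem ordKatoHalfAtTwoIso_of_memo_cite (hF1 : DivisibilityInputsFineZetaAtTwoResidue)
    (hAU : abbesUllmo_not_dvd_maninConstant_of_not_dvd_level)
    (hB7 : KatoMuPartAtOptimalMemberOfNotSurjectiveTwo) (hB8 : KatoIntAtGoodOrdSurjectiveTwo)
    (hPub : OrdPublishedInputsAtTwo) : OrdKatoHalfAtTwoIso := by
  obtain ⟨_, _, h17, _⟩ := hPub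
  exact ordKatoHalfAtTwoIso_of_sockets coreTheoremATwoResidue_holds hF1 hAU hB7 hB8 h17

end Summit.BirchSwinnertonDyer.BirchSwinnertonDyer.Theorems.SteinbergFibreAtTwo

end
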